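import Summits.QuantumFields.YangMills.Theorems.LuscherReductionDressedRitzPolyakovLiftBasisGenericL
import Summits.QuantumFields.YangMills.Theorems.LuscherReductionDressedRitzPolyakovLiftGlue
import Summits.QuantumFields.YangMills.Theorems.LuscherReductionDressedRitzPolyakovLiftTransplantRootR
import Summits.QuantumFields.YangMills.Theorems.FemtoTransferGapBlockToFine
import HarnessLib

/-!
# Route `LuscherReduction`, item `DressedRitz` (stmt-QuantumFields-20205), line «polyakovlift» r8 — S-LEAK IN BLOCK CURRENCY:
# `LeakageForL P ⟸ BlockLeakageForL P` for every physical basis predicate (LEAD prover ym-lead-20205-polyakovlift g4; `--supports stmt-QuantumFields-20205`)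

The registered stub `stub_liftLeakage : ∀ k, LeakageForL (TransplantBasisLR k)` (skeleton r8 7611d10d84d95233) asks, for every transplant basis, the
FINE time-2 clause (o4) of the dressed lifted family `u_i = K_β^{L} v_i` (`v_i = liftVec β φ g_i`, `dressSteps L = L`) at the `L`-DEPENDENT tolerance
`C·λ³/L²`.  By the block-to-fine door (`FemtoTransferGapBlockToFine`, defect contraction (c): the fine one-step defect of a once-block-dressed vector is
at most `600/ℓ²` times its block defects) this follows from an `L`-FREE statement about BLOCK-ALIGNED two-point data only:

* `BlockLeakageForL P` (NEW text, same quantifier shell as `LeakageForL`): for every basis in `P` and every channel `i`, the RAW lift `v_i` and the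
  DRESSED lift `u_i` have block defects (block = `dressSteps L = L` transfer steps; Euclidean times `0, L, 2L` resp. `2L, 3L, 4L`) at most `C·λ³`:
  `⟨v,K^{2L}v⟩⟨v,v⟩ ≤ (1 + Cλ³)⟨v,K^{L}v⟩²` and `⟨u,K^{2L}u⟩⟨u,u⟩ ≤ (1 + Cλ³)⟨u,K^{L}u⟩²`;
* ★ `leakageForL_of_blockLeakageForL : BasisPhysL P → BlockLeakageForL P → LeakageForL P` (constant `600·C`; the window is shrunk so that `Cλ³ ≤ 1/32`);
* ★ `stubR8_liftLeakage_of_block : (∀ k, BlockLeakageForL (TransplantBasisLR k)) → ∀ k, LeakageForL (TransplantBasisLR k)` — r8's `stub_liftLeakage`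
  text VERBATIM from its block-currency form.

WHY (crux idea «block-endpoint», `Cruxes/DressedRitz/Ideas/block-endpoint.md` §(3)/(ii)): a renormalisation-group supplier working with Bałaban block
averages delivers expectations of block observables at BLOCK-ALIGNED separations; the door manufactures the `1/L²` of (o4) deterministically, so the RG is
asked for the relative precision `λ³` and never for an `L`-dependent one.  Physics size check: the flowed, vacuum-subtracted insertion has contamination
weight `O(λ²)` on neighbouring zero-mode levels (`(λ^ℓ-shift)² = O(λ²)` ⇒ block defect `O(λ⁴)`) and super-exponentially small stiff weight
(`flowTime`), so `Cλ³` has a power of `λ` to spare.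

HONEST FRAMING: a typed reduction on the CONDITIONAL femto rung R2b1; `BlockLeakageForL (TransplantBasisLR k)` is an OPEN renormalisation-group estimate
exactly like `stub_liftLeakage` (not in print); nothing here bears on infinite volume, the continuum limit or the Clay gap.
References: M. Lüscher, NPB 219 (1983) 233 [cite: Luscher1983, §3]; M. Lüscher, U. Wolff, NPB 339 (1990) 222 [cite: LuscherWolff1990];
T. Bałaban, CMP 98 (1985) 17 [cite: Balaban1985Averaging, (10)–(11)].
-/

set_option autoImplicit false

noncomputable section

open MeasureTheory Filter Topology Real
open Literature.MathematicalPhysics.QuantumFieldTheory (GaugeConfig Site gaugeTransform)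
open scoped BigOperators

namespace Summit.QuantumFields.YangMills.Theorems.FemtoTransferGap.PolyakovLift

open Summit.QuantumFields.YangMills.Theorems.FemtoTransferGap

variable {k : ℕ}

/-! ## §1 The block-currency text -/

/-- **BLOCK-LEAKAGE for the basis predicate `P`**: along the femto window, for every raw vacuum, every basis in `P` and every channel, the raw lift
`v = liftVec β φ g_i` and the dressed lift `u = dressedLiftVec β φ g_i = K_β^{L} v` have BLOCK DEFECTS at most `C·λ³` for the block `P = K_β^{L}`
(`L = dressSteps L` transfer steps): `⟨v,K^{2L}v⟩·⟨v,v⟩ ≤ (1 + Cλ³)·⟨v,K^{L}v⟩²` and `⟨u,K^{2L}u⟩·⟨u,u⟩ ≤ (1 + Cλ³)·⟨u,K^{L}u⟩²` — block-aligned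
two-point data at Euclidean times `0, L, 2L, 3L, 4L`, `L`-FREE relative precision. OPEN (RG). [cite: Luscher1983, §3] [cite: LuscherWolff1990] -/
def BlockLeakageForL (P : ℕ → ℝ → (Fin k → (GaugeConfig 3 1 SU2 → ℝ)) → Prop) : Prop :=
  ∃ C lam0 : ℝ, 0 ≤ C ∧ 0 < lam0 ∧ ∀ lam : ℝ, 0 < lam → lam ≤ lam0 → ∃ L0 : ℕ,
    ∀ (L : ℕ) [NeZero L], L0 ≤ L → ∀ β : ℝ, InFemtoWindow lam β L →
      ∀ φ : GaugeConfig 3 L SU2 → ℝ, IsRawVacuum β φ →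
        ∀ g : Fin k → (GaugeConfig 3 1 SU2 → ℝ), P L (luscherLambda β L) g → ∀ i : Fin k,
          l2 (liftVec β φ (g i)) ((transferApply β)^[2 * dressSteps L] (liftVec β φ (g i))) * l2 (liftVec β φ (g i)) (liftVec β φ (g i)) ≤
              (1 + C * luscherLambda β L ^ 3) * l2 (liftVec β φ (g i)) ((transferApply β)^[dressSteps L] (liftVec β φ (g i))) ^ 2 ∧
          l2 (dressedLiftVec β φ (g i)) ((transferApply β)^[2 * dressSteps L] (dressedLiftVec β φ (g i))) *
                l2 (dressedLiftVec β φ (g i)) (dressedLiftVec β φ (g i)) ≤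
              (1 + C * luscherLambda β L ^ 3) * l2 (dressedLiftVec β φ (g i)) ((transferApply β)^[dressSteps L] (dressedLiftVec β φ (g i))) ^ 2

/-! ## §2 ★ Block leakage ⟹ fine leakage (o4), for any physical basis predicate -/

/-- Window arithmetic: if `lam ≤ min 1 (1/(256C+1))` and `λ ∈ [lam, 2lam]` then `C·λ³ ≤ 1/32`. [folklore] -/
theorem C_mul_cube_le {C lam Λ : ℝ} (hC : 0 ≤ C) (hlam : 0 < lam) (h1 : lam ≤ 1) (h2 : lam ≤ 1 / (256 * C + 1))
    (hΛ0 : lam ≤ Λ) (hΛ : Λ ≤ 2 * lam) : C * Λ ^ 3 ≤ 1 / 32 := by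
  have hΛ1 : Λ ≤ 2 := by linarith
  have hΛpos : 0 < Λ := by linarith
  have hcube : Λ ^ 3 ≤ 8 * lam := by nlinarith [mul_le_mul hΛ hΛ (by linarith) (by linarith), hΛpos]
  have h256 : (256 * C + 1) * lam ≤ 1 := by
    rwa [le_div_iff₀ (by positivity), mul_comm] at h2
  nlinarith [mul_le_mul_of_nonneg_left hcube hC]

/-- ★★ **`BlockLeakageForL P ⟹ LeakageForL P`** (members physical), constant `600·C`: the block-to-fine door (`BlockToFine.leakage_of_blockDefects`, defect
contraction by `1/L²` for `ℓ = dressSteps L = L`) turns the two `L`-free block defects `≤ Cλ³` into (o4) at `600C·λ³/L²`. [cite: LuscherWolff1990] -/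
theorem leakageForL_of_blockLeakageForL {P : ℕ → ℝ → (Fin k → (GaugeConfig 3 1 SU2 → ℝ)) → Prop} (hP : BasisPhysL P)
    (h : BlockLeakageForL P) : LeakageForL P := by
  obtain ⟨C, lam0, hC, hlam0, hk⟩ := h
  refine ⟨600 * C, min lam0 (min 1 (1 / (256 * C + 1))), by positivity,
    lt_min hlam0 (lt_min one_pos (by positivity)), fun lam hlam hle => ?_⟩
  obtain ⟨L0, hL0⟩ := hk lam hlam (hle.trans (min_le_left _ _))
  refine ⟨L0, fun L _ hL β hW φ hφ g hg i => ?_⟩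
  have hle1 : lam ≤ 1 := hle.trans ((min_le_right _ _).trans (min_le_left _ _))
  have hle2 : lam ≤ 1 / (256 * C + 1) := hle.trans ((min_le_right _ _).trans (min_le_right _ _))
  have hβ : 0 < β := zero_lt_one.trans_le hW.1
  have hLpos : 1 ≤ L := NeZero.one_le
  set δ := C * luscherLambda β L ^ 3 with hδ
  have hΛpos : 0 < luscherLambda β L := luscherLambda_pos_of_window hlam hW
  have hδ0 : 0 ≤ δ := by positivity
  have hδ1 : δ ≤ 1 / 32 := C_mul_cube_le hC hlam hle1 hle2 hW.2.1 hW.2.2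
  obtain ⟨hraw, hdress⟩ := hL0 L hL β hW φ hφ g hg i
  have hv : IsPhys (liftVec β φ (g i)) := isPhys_liftVec β hφ.1 (hP _ _ _ hg i)
  -- the dressed vector IS `K^[L] v`
  have hu : dressedLiftFamily β φ g i = (transferApply β)^[L] (liftVec β φ (g i)) := rfl
  have hds : dressSteps L = L := rfl
  rw [hds] at hraw hdress
  change l2 ((transferApply β)^[L] (liftVec β φ (g i))) ((transferApply β)^[2 * L] ((transferApply β)^[L] (liftVec β φ (g i)))) *
      l2 ((transferApply β)^[L] (liftVec β φ (g i))) ((transferApply β)^[L] (liftVec β φ (g i))) ≤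
    (1 + δ) * l2 ((transferApply β)^[L] (liftVec β φ (g i))) ((transferApply β)^[L] ((transferApply β)^[L] (liftVec β φ (g i)))) ^ 2 at hdress
  have hdoor := BlockToFine.leakage_of_blockDefects hβ hv hLpos hδ0 hδ1 hraw hdress
  rw [hu]
  calc _ ≤ 600 * δ / (L : ℝ) ^ 2 * levelValue su2Rep L β 0 ^ 2 *
        l2 ((transferApply β)^[L] (liftVec β φ (g i))) ((transferApply β)^[L] (liftVec β φ (g i))) ^ 2 := hdoor
    _ = 600 * C * (luscherLambda β L ^ 3 / (L : ℝ) ^ 2) * levelValue su2Rep L β 0 ^ 2 *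
        l2 ((transferApply β)^[L] (liftVec β φ (g i))) ((transferApply β)^[L] (liftVec β φ (g i))) ^ 2 := by rw [hδ]; ring

/-! ## §3 ★ Skeleton r8: `stub_liftLeakage` from its block-currency form -/

/-- ★ **r8's `stub_liftLeakage` text VERBATIM from BLOCK LEAKAGE of every transplant basis** (`TransplantBasisLR k` members are physical:
`basisPhysL_transplantBasisLR`). [cite: Luscher1983, §3] [cite: LuscherWolff1990] -/
theorem stubR8_liftLeakage_of_block (h : ∀ k, BlockLeakageForL (TransplantBasisLR k)) : ∀ k : ℕ, LeakageForL (TransplantBasisLR k) :=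
  fun k => leakageForL_of_blockLeakageForL (basisPhysL_transplantBasisLR k) (h k)

end Summit.QuantumFields.YangMills.Theorems.FemtoTransferGap.PolyakovLift

end
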